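import Summits.CriticalPhenomena.PercolationContinuityZ3.Theorems.Transplant.AutRelMilnorKernelTwo
import Summits.CriticalPhenomena.PercolationContinuityZ3.Theorems.Transplant.AutChartCylinders
import Summits.CriticalPhenomena.PercolationContinuityZ3.Theorems.Transplant.FrmScaledTranslatingGroup
import Summits.CriticalPhenomena.PercolationContinuityZ3.Theorems.Transplant.ExpGrowthCriticalProbLtOne
import HarnessLib

/-!
# INPUT(G) WITHOUT FINITE STABILISERS: `θ_v(p_c) = 0` on every connected locally finite graph with a TRANSITIVE group of automorphisms and a
# homomorphism to `ℤ²` of rank-two image killing a vertex stabiliser — modulo the one-type scaled node ALONE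

builds on p205010 (kernel theorem, internal audit signed; external expert review pending) — nothing in this file uses p205010.  The percolation theorems are CONDITIONAL on the OPEN node `SamePDropOfSkeletonFrmScaled₁`
(hypothesis `hN`; nothing is claimed about it) and on NOTHING ELSE.  Lane `prim-bschramm`, seat `prim-bschramm-p4` gen 25 (PART C3 of
`P4-GENERAL.md` §47).  Helper file (`--supports stmt-CriticalPhenomena-4575 --as helper`).

THE THEOREM (`AutChart.criticalContinuity`).  `G` connected, locally finite; `A` acting on `V(G)` by automorphisms, transitively — stabilisers
ARBITRARY; `c : A → ℤ²` a homomorphism of rank-2 image with `c(Stab(t)) = 0` for one vertex `t`.  Then `θ_v(p_c(G)) = 0` at every vertex, modulo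
the scaled node.  Gen 24 (`FrmScaledAut.translating_transitive_rankTwo`) showed that every one-type scaled skeleton carrier has such an `(A, c)`
(the chart-translating automorphisms; their characters kill the stabilisers), and that the finite-stabiliser theorem `AutScaled.criticalContinuity`
missed exactly the stabiliser; this file removes it: OFF exponential growth the hypotheses GIVE a one-type scaled skeleton (`exists_oneType_skeleton`),
so — off exponential growth, where Conj. 4 is open — INPUT(G) is EQUIVALENT to the interface of the open node, and the conditional theorem is
optimal for the method.  Chart form (`criticalContinuity_of_chart`, `criticalContinuity_of_autSubgroup`): a chart `φ : V → ℤ²` translated by a transitive group of automorphisms with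
values of rank two suffices — no step, Lipschitz, cylinder, stabiliser or growth hypothesis; `exists_oneType_skeleton_iff`: off exponential growth a one-type
`PlanarSkeletonFrmScaled` EXISTS iff some subgroup of `Aut(G)` acts transitively translating a rank-two chart.  Unconditionally the scope is never
vacuous: `criticalProb_lt_one` (`p_c < 1`; Conj. 4 in its own shape `conj4`, modulo `U_s`).
THE PROOF.  ON exponential growth: Hutchcroft.  OFF it: the movers of `t` to its neighbours and `Stab(t)` generate `A` (`closure_movers_eq_top`);
`c` has rank two on the movers (`exists_indep_movers`); re-base on a pair of mover images of maximal area (`MaxArea.exists_rebase`: exact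
`N`-steps, sup-norm `≤ N`); the relative Milnor kernel lemma (`AutMilnor.ker_eq_closure_bounded`) bounds the kernel displacement; this is a
`ChartDatum` (`exists_datum`), whose `skeleton` feeds `continuity_of_frmScaledNode₁_ray`.
[cite: BenjaminiSchramm1996, Conj. 4; §2 (almost transitive graphs)] [cite: Hutchcroft2016, Thm. 1.1] [cite: MilnorSolvableGrowth1968, Lemma 1]
[cite: MartineauTassion2017, §3.2 (good coordinates)] [cite: KozmaNitzan2024, §4 p. 16 (Lemma 8)]
-/

noncomputable section

namespace Summit.CriticalPhenomena.PercolationContinuityZ3.Theorems.Transplant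

open SimpleGraph Filter Literature.Barriers.CriticalPhenomena Literature.Probability.LatticeModels Literature.Probability.Percolation
open scoped Classical

namespace AutChart

variable {V : Type} {G : SimpleGraph V} {A : Type} [Group A] [MulAction A V] {t : V}

/-! ### The datum from a rank-two character killing the stabiliser, off exponential growth -/

section Construct

variable [G.LocallyFinite]

/-- **The movers of `t` to its neighbours, together with `Stab(t)`, generate a transitive group** (walk induction from `t`).
[cite: BenjaminiSchramm1996, §2 (almost transitive graphs)] -/
theorem closure_movers_eq_top (hact : IsActionByAut G A) (hc : G.Connected) (htr : ∀ v : V, ∃ a : A, a • t = v) :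
    Subgroup.closure (↑((G.neighborFinset t).image (AutScaled.sec htr)) ∪ (↑(MulAction.stabilizer A t) : Set A)) = ⊤ := by
  set H := Subgroup.closure (↑((G.neighborFinset t).image (AutScaled.sec htr)) ∪ (↑(MulAction.stabilizer A t) : Set A)) with hH
  have key : ∀ (x y : V) (p : G.Walk x y), y = t → ∃ b ∈ H, b • t = x := by
    intro x y p
    induction p with
    | nil => intro hy; exact ⟨1, one_mem _, by rw [one_smul]; exact hy.symm⟩
    | @cons x z y hxz p ih =>
      intro hy
      obtain ⟨b, hb, hbz⟩ := ih hy
      have hadj : G.Adj t (b⁻¹ • x) := by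
        have h1 : G.Adj (b⁻¹ • x) (b⁻¹ • z) := (hact b⁻¹ x z).2 hxz
        rw [← hbz, inv_smul_smul] at h1
        exact h1.symm
      have hmem : AutScaled.sec htr (b⁻¹ • x) ∈ (G.neighborFinset t).image (AutScaled.sec htr) :=
        Finset.mem_image_of_mem _ ((G.mem_neighborFinset t _).2 hadj)
      refine ⟨b * AutScaled.sec htr (b⁻¹ • x), mul_mem hb (Subgroup.subset_closure (Set.mem_union_left _ (Finset.mem_coe.2 hmem))), ?_⟩
      rw [mul_smul, AutScaled.sec_smul, smul_inv_smul]
  refine (Subgroup.eq_top_iff' H).2 fun a₀ => ?_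
  obtain ⟨p⟩ := hc.preconnected (a₀ • t) t
  obtain ⟨b, hb, hbt⟩ := key _ _ p rfl
  have hσ : b⁻¹ * a₀ ∈ MulAction.stabilizer A t := by
    rw [MulAction.mem_stabilizer_iff, mul_smul, ← hbt, inv_smul_smul]
  have e : a₀ = b * (b⁻¹ * a₀) := by group
  rw [e]
  exact mul_mem hb (Subgroup.subset_closure (Set.mem_union_right _ hσ))

/-- **A character of rank two killing the stabiliser is of rank two ON THE MOVERS** (otherwise all its values are parallel). [folklore] -/
theorem exists_indep_movers (hact : IsActionByAut G A) (hc : G.Connected) (htr : ∀ v : V, ∃ a : A, a • t = v)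
    (c : A →* Multiplicative (Site 2)) (hstab : ∀ h ∈ MulAction.stabilizer A t, c h = 1)
    (hrank : ∃ a b : A, MaxArea.det2 (Multiplicative.toAdd (c a)) (Multiplicative.toAdd (c b)) ≠ 0) :
    ∃ u ∈ ((G.neighborFinset t).image (AutScaled.sec htr)).image (fun a => Multiplicative.toAdd (c a)),
      ∃ v ∈ ((G.neighborFinset t).image (AutScaled.sec htr)).image (fun a => Multiplicative.toAdd (c a)), MaxArea.det2 u v ≠ 0 := by
  set T := (G.neighborFinset t).image (AutScaled.sec htr) with hT_def
  set φ : A → Site 2 := fun a => Multiplicative.toAdd (c a) with hφ_def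
  have φ_mul : ∀ a b, φ (a * b) = φ a + φ b := fun a b => by simp only [hφ_def, map_mul, toAdd_mul]
  have φ_one : φ 1 = 0 := by simp only [hφ_def, map_one, toAdd_one]
  have φ_inv : ∀ a, φ a⁻¹ = -φ a := fun a => by simp only [hφ_def, map_inv, toAdd_inv]
  have φ_stab : ∀ h ∈ MulAction.stabilizer A t, φ h = 0 := fun h hh => by simp only [hφ_def, hstab h hh, toAdd_one]
  have hgen := closure_movers_eq_top hact hc htr
  by_contra hno
  push Not at hno
  have hno' : ∀ s ∈ T, ∀ s' ∈ T, MaxArea.det2 (φ s) (φ s') = 0 := fun s hs s' hs' =>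
    hno _ (Finset.mem_image_of_mem _ hs) _ (Finset.mem_image_of_mem _ hs')
  have par : ∀ w : Site 2, (∀ s ∈ T, MaxArea.det2 (φ s) w = 0) → ∀ x : A, MaxArea.det2 (φ x) w = 0 := by
    intro w hw x
    have hx : x ∈ Subgroup.closure (↑T ∪ (↑(MulAction.stabilizer A t) : Set A)) := by rw [hgen]; exact Subgroup.mem_top x
    induction hx using Subgroup.closure_induction with
    | mem y hy =>
      rcases hy with hy | hy
      · exact hw y (Finset.mem_coe.1 hy)
      · rw [φ_stab y hy, MaxArea.det2_zero_left]
    | one => rw [φ_one, MaxArea.det2_zero_left]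
    | mul y z _ _ hy hz => rw [φ_mul, MaxArea.det2_add_left, hy, hz, add_zero]
    | inv y _ hy => rw [φ_inv, MaxArea.det2_neg_left, hy, neg_zero]
  obtain ⟨g, h, hgh⟩ := hrank
  change MaxArea.det2 (φ g) (φ h) ≠ 0 at hgh
  by_cases hall : ∀ s ∈ T, φ s = 0
  · have h0 : ∀ x : A, φ x = 0 := by
      intro x
      have hx : x ∈ Subgroup.closure (↑T ∪ (↑(MulAction.stabilizer A t) : Set A)) := by rw [hgen]; exact Subgroup.mem_top x
      induction hx using Subgroup.closure_induction with
      | mem y hy =>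
        rcases hy with hy | hy
        · exact hall y (Finset.mem_coe.1 hy)
        · exact φ_stab y hy
      | one => exact φ_one
      | mul y z _ _ hy hz => rw [φ_mul, hy, hz, add_zero]
      | inv y _ hy => rw [φ_inv, hy, neg_zero]
    exact hgh (by rw [h0 g, MaxArea.det2_zero_left])
  · push Not at hall
    obtain ⟨s₀, hs₀, hw⟩ := hall
    have hpar : ∀ x : A, MaxArea.det2 (φ x) (φ s₀) = 0 := par (φ s₀) (fun s hs => hno' s hs s₀ hs₀)
    exact hgh (CayleyScaled.det2_eq_zero_of_parallel hw (hpar g) (hpar h))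

/-- **THE DATUM EXISTS**: a transitive action by automorphisms of a connected locally finite graph WITHOUT exponential growth, and a character
`c : A → ℤ²` of rank-2 image killing `Stab(t)`, give a `ChartDatum` at `t` — re-base `c` on a pair of mover images of maximal area (exact `N`-steps,
sup-norm `≤ N` on movers), and bound the kernel displacement by the relative Milnor kernel lemma (rank two). [cite: MilnorSolvableGrowth1968, Lemma 1]
[cite: MartineauTassion2017, §3.2 (good coordinates)] [cite: BenjaminiSchramm1996, §2 (almost transitive graphs)] -/
theorem exists_datum (hact : IsActionByAut G A) (hc : G.Connected) (htr : ∀ v : V, ∃ a : A, a • t = v)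
    (c : A →* Multiplicative (Site 2)) (hstab : ∀ h ∈ MulAction.stabilizer A t, c h = 1)
    (hrank : ∃ a b : A, MaxArea.det2 (Multiplicative.toAdd (c a)) (Multiplicative.toAdd (c b)) ≠ 0) (hG : ¬ HasExponentialGrowth G) :
    Nonempty (ChartDatum G A t) := by
  set T := (G.neighborFinset t).image (AutScaled.sec htr) with hT_def
  obtain ⟨u, hu, v, hv, hD, hAu, hAv, hbd⟩ :=
    MaxArea.exists_rebase (T.image (fun a => Multiplicative.toAdd (c a))) (exists_indep_movers hact hc htr c hstab hrank)
  obtain ⟨τ₀, hτ₀, hcu⟩ := Finset.mem_image.1 hu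
  obtain ⟨τ₁, hτ₁, hcv⟩ := Finset.mem_image.1 hv
  obtain ⟨m, hm⟩ := AutMilnor.ker_eq_closure_bounded hact hc t (AutMilnor.subexp_of_not_hasExponentialGrowth hact htr hG) T
    (closure_movers_eq_top hact hc htr) c hstab
  have hTadj : ∀ τ ∈ T, G.Adj t (τ • t) := by
    intro τ hτ
    obtain ⟨w, hw, rfl⟩ := Finset.mem_image.1 hτ
    rw [AutScaled.sec_smul]
    exact (G.mem_neighborFinset t w).1 hw
  have hc_eq : ∀ a : A, G.Adj t (a • t) → c a = c (AutScaled.sec htr (a • t)) := by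
    intro a _
    have hs : (AutScaled.sec htr (a • t))⁻¹ * a ∈ MulAction.stabilizer A t := by
      rw [MulAction.mem_stabilizer_iff, mul_smul, inv_smul_eq_iff, AutScaled.sec_smul]
    have h1 := hstab _ hs
    rw [map_mul, map_inv, inv_mul_eq_one] at h1
    exact h1.symm
  refine ⟨{ act := hact, tr := htr, conn := hc
            ψ := fun a => MaxArea.rebase u v (Multiplicative.toAdd (c a))
            ψ_mul := fun a b => by simp only [map_mul, toAdd_mul, MaxArea.rebase_add]
            ψ_stab := fun h hh => by simp only [hstab h hh, toAdd_one, MaxArea.rebase_zero]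
            N := (MaxArea.det2 u v).natAbs
            one_le_N := Int.natAbs_pos.2 hD
            lipN := ?_
            gen := fun i => if i = 0 then τ₀ else τ₁
            gen_adj := ?_
            ψ_gen := ?_
            m := m
            ker_gen := ?_ }⟩
  · intro a ha i
    have hw : a • t ∈ G.neighborFinset t := (G.mem_neighborFinset t _).2 ha
    have hτT : AutScaled.sec htr (a • t) ∈ T := Finset.mem_image_of_mem _ hw
    show |MaxArea.rebase u v (Multiplicative.toAdd (c a)) i| ≤ ((MaxArea.det2 u v).natAbs : ℤ)
    rw [Int.natCast_natAbs, hc_eq a ha]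
    exact hbd _ (Finset.mem_image_of_mem _ hτT) i
  · intro i
    fin_cases i
    · exact hTadj τ₀ hτ₀
    · exact hTadj τ₁ hτ₁
  · intro i
    fin_cases i
    · show MaxArea.rebase u v (Multiplicative.toAdd (c τ₀)) = Pi.single 0 (((MaxArea.det2 u v).natAbs : ℕ) : ℤ)
      rw [hcu, hAu, Int.natCast_natAbs]
    · show MaxArea.rebase u v (Multiplicative.toAdd (c τ₁)) = Pi.single 1 (((MaxArea.det2 u v).natAbs : ℕ) : ℤ)
      rw [hcv, hAv, Int.natCast_natAbs]
  · intro k hk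
    have hk1 : k ∈ c.ker := by
      rw [MonoidHom.mem_ker, ← ofAdd_toAdd (c k), MaxArea.eq_zero_of_rebase_eq_zero hD hk, ofAdd_zero]
    have hsub : {g | g ∈ c.ker ∧ g • t ∈ graphBall G t m} ⊆
        {g : A | MaxArea.rebase u v (Multiplicative.toAdd (c g)) = 0 ∧ g • t ∈ graphBall G t m} := by
      rintro g ⟨hg, hgm⟩
      refine ⟨?_, hgm⟩
      rw [MonoidHom.mem_ker] at hg
      rw [hg, toAdd_one, MaxArea.rebase_zero]
    exact Subgroup.closure_mono hsub (hm.le hk1)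

end Construct

/-! ## THE THEOREM: INPUT(G) = a transitive group of automorphisms with a rank-two character killing a stabiliser (modulo `U_s` alone) -/

variable [G.LocallyFinite]

/-- **THEOREM (modulo the scaled node ALONE) — INPUT(G) WITHOUT FINITE STABILISERS**: `G` connected and locally finite, `A` acting on `V(G)` by
automorphisms, TRANSITIVELY (stabilisers arbitrary — infinite, uncountable, `A` not finitely generated: all allowed), and a homomorphism
`c : A → ℤ²` of rank-2 image KILLING THE STABILISER of one (hence every) vertex ⟹ `θ_v(p_c(G)) = 0` at every vertex.  ON exponential growth of
`G`: Hutchcroft.  OFF it: the relative Milnor kernel lemma bounds the kernel displacement, `exists_datum` re-bases `c`, and `G` carries the ONE-TYPE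
scaled skeleton `ChartDatum.skeleton`; then `continuity_of_frmScaledNode₁_ray`.  Supersedes `AutScaled.criticalContinuity` (finite stabilisers:
a character kills a finite stabiliser automatically, `map_stabilizer_eq_one_of_finite` below). [cite: BenjaminiSchramm1996, Conj. 4; §2 (almost transitive graphs)] [cite: Hutchcroft2016, Thm. 1.1]
[cite: MilnorSolvableGrowth1968, Lemma 1] -/
theorem criticalContinuity (hN : SamePDropOfSkeletonFrmScaled₁) (hact : IsActionByAut G A) (hc : G.Connected) (t : V)
    (htr : ∀ v : V, ∃ a : A, a • t = v) (c : A →* Multiplicative (Site 2)) (hstab : ∀ h ∈ MulAction.stabilizer A t, c h = 1)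
    (hrank : ∃ a b : A, MaxArea.det2 (Multiplicative.toAdd (c a)) (Multiplicative.toAdd (c b)) ≠ 0) (v : V) :
    theta G v (criticalProbIOf G v) = 0 := by
  by_cases hG : HasExponentialGrowth G
  · exact Hutchcroft2016_noPercolationAtCriticality_holds G hc (AutScaled.isQuasiTransitive_of_action hact htr) hG v
  · obtain ⟨D⟩ := exists_datum hact hc htr c hstab hrank hG
    exact continuity_of_frmScaledNode₁_ray hN G D.skeleton t (Finset.mem_singleton_self t) rfl v

/-- … and `θ_v(p) = 0` for every `p ≤ p_c`. [cite: BenjaminiSchramm1996, Conj. 4; §2] -/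
theorem theta_eq_zero_of_le (hN : SamePDropOfSkeletonFrmScaled₁) (hact : IsActionByAut G A) (hc : G.Connected) (t : V)
    (htr : ∀ v : V, ∃ a : A, a • t = v) (c : A →* Multiplicative (Site 2)) (hstab : ∀ h ∈ MulAction.stabilizer A t, c h = 1)
    (hrank : ∃ a b : A, MaxArea.det2 (Multiplicative.toAdd (c a)) (Multiplicative.toAdd (c b)) ≠ 0) (v : V) {p : unitInterval}
    (hp : (p : ℝ) ≤ criticalProb G v) : theta G v p = 0 := by
  haveI : Countable V := countable_of_connected_of_locallyFinite G hc t
  rcases hp.lt_or_eq with hlt | heq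
  · exact theta_eq_zero_of_lt_criticalProb_holds G v p hlt
  · have e : p = criticalProbIOf G v := Subtype.ext heq
    rw [e]
    exact criticalContinuity hN hact hc t htr c hstab hrank v

/-- **UNCONDITIONAL: the scope is never vacuous — `p_c(G) < 1`** for every connected locally finite graph with a transitive group of automorphisms
and a character to `ℤ²` of rank-two image killing a stabiliser (ON exponential growth by Hutchcroft's Thm 2, OFF it from the exact `N`-steps of the skeleton:
the coarse chart is a weak covering of `ℤ²`).  Generalises gen 22's `AutZSq`/`AutRank` rows (finite stabilisers). [cite: BenjaminiSchramm1996, §2 Conj. 1; Thm. 1]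
[cite: Hutchcroft2016, Thm. 2] -/
theorem criticalProb_lt_one (hact : IsActionByAut G A) (hc : G.Connected) (t : V) (htr : ∀ v : V, ∃ a : A, a • t = v)
    (c : A →* Multiplicative (Site 2)) (hstab : ∀ h ∈ MulAction.stabilizer A t, c h = 1)
    (hrank : ∃ a b : A, MaxArea.det2 (Multiplicative.toAdd (c a)) (Multiplicative.toAdd (c b)) ≠ 0) (v : V) : criticalProb G v < 1 := by
  by_cases hG : HasExponentialGrowth G
  · exact ExpGrowth.criticalProb_lt_one_of_hasExponentialGrowth G hc (AutScaled.isQuasiTransitive_of_action hact htr) hG v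
  · obtain ⟨D⟩ := exists_datum hact hc htr c hstab hrank hG
    exact D.skeleton.criticalProb_lt_one_frmScaled hc v

/-- **Conj. 4 in its own shape on this class (modulo `U_s`)**: `p_c < 1` (unconditionally) AND `θ_v(p_c) = 0`. [cite: BenjaminiSchramm1996, Conj. 4] -/
theorem conj4 (hN : SamePDropOfSkeletonFrmScaled₁) (hact : IsActionByAut G A) (hc : G.Connected) (t : V)
    (htr : ∀ v : V, ∃ a : A, a • t = v) (c : A →* Multiplicative (Site 2)) (hstab : ∀ h ∈ MulAction.stabilizer A t, c h = 1)
    (hrank : ∃ a b : A, MaxArea.det2 (Multiplicative.toAdd (c a)) (Multiplicative.toAdd (c b)) ≠ 0) (v : V) :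
    criticalProb G v < 1 ∧ theta G v (criticalProbIOf G v) = 0 :=
  ⟨criticalProb_lt_one hact hc t htr c hstab hrank v, criticalContinuity hN hact hc t htr c hstab hrank v⟩

/-- **OFF exponential growth the hypotheses give a ONE-TYPE scaled skeleton** (the interface of the open node `U_s`): with gen 24's converse
`FrmScaledAut.translating_transitive_rankTwo` (every one-type `PlanarSkeletonFrmScaled` carrier has a transitive chart-translating group of
automorphisms with two independent characters, which kill the stabilisers), INPUT(G) is — off exponential growth, where Conj. 4 is open —
EQUIVALENT to carrying the node's interface: the conditional theorem is optimal for the method. [cite: BenjaminiSchramm1996, Conj. 4]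
[cite: KozmaNitzan2024, §4 p. 16 (Lemma 8)] -/
theorem exists_oneType_skeleton (hact : IsActionByAut G A) (hc : G.Connected) (t : V) (htr : ∀ v : V, ∃ a : A, a • t = v)
    (c : A →* Multiplicative (Site 2)) (hstab : ∀ h ∈ MulAction.stabilizer A t, c h = 1)
    (hrank : ∃ a b : A, MaxArea.det2 (Multiplicative.toAdd (c a)) (Multiplicative.toAdd (c b)) ≠ 0) (hG : ¬ HasExponentialGrowth G) :
    ∃ Φ : PlanarSkeletonFrmScaled G, Φ.types = {t} := by
  obtain ⟨D⟩ := exists_datum hact hc htr c hstab hrank hG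
  exact ⟨D.skeleton, rfl⟩

/-- **A character of a group with FINITE stabiliser kills the stabiliser** (its image there is a finite subgroup of the torsion-free `ℤ²`) — so the
finite-stabiliser theorem `AutScaled.criticalContinuity` is the special case `|Stab(t)| < ∞` of `criticalContinuity` (feed this lemma as `hstab`). [folklore] -/
theorem map_stabilizer_eq_one_of_finite (hfin : (MulAction.stabilizer A t : Set A).Finite) (c : A →* Multiplicative (Site 2)) :
    ∀ h ∈ MulAction.stabilizer A t, c h = 1 := by
  intro σ hσ
  haveI : Finite (MulAction.stabilizer A t) := hfin.to_subtype
  obtain ⟨n, hn, hpow⟩ := (isOfFinOrder_of_finite (⟨σ, hσ⟩ : MulAction.stabilizer A t)).exists_pow_eq_one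
  have hpow' : σ ^ n = 1 := by
    have := congrArg Subtype.val hpow
    simpa using this
  have h : n • Multiplicative.toAdd (c σ) = 0 := by
    rw [← toAdd_pow, ← map_pow, hpow', map_one, toAdd_one]
  rw [← ofAdd_toAdd (c σ), ← ofAdd_zero]
  congr 1
  funext i
  have hi : (n : ℤ) * Multiplicative.toAdd (c σ) i = 0 := by
    have := congrFun h i
    rwa [Pi.smul_apply, nsmul_eq_mul] at this
  rcases mul_eq_zero.1 hi with h0 | h0
  · exact absurd (by exact_mod_cast h0 : n = 0) (by omega)
  · exact h0

/-! ## The chart form: a rank-two chart `V → ℤ²` translated by a transitive group of automorphisms -/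

/-- The character `a ↦ φ(a • t) − φ(t)` of a chart translated by the action. [folklore] -/
def chartHom (t : V) (φ : V → Site 2) (hφ : ∀ (a : A) (w : V), φ (a • w) = φ w + (φ (a • t) - φ t)) : A →* Multiplicative (Site 2) where
  toFun a := Multiplicative.ofAdd (φ (a • t) - φ t)
  map_one' := by rw [one_smul, sub_self, ofAdd_zero]
  map_mul' a b := by
    rw [← ofAdd_add, mul_smul, hφ a (b • t)]
    congr 1
    abel

/-- `toAdd (chartHom a) = φ(a • t) − φ t`. [folklore] -/
@[simp] theorem toAdd_chartHom (t : V) (φ : V → Site 2) (hφ : ∀ (a : A) (w : V), φ (a • w) = φ w + (φ (a • t) - φ t)) (a : A) :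
    Multiplicative.toAdd (chartHom t φ hφ a) = φ (a • t) - φ t := rfl

/-- **THEOREM (chart form, modulo the scaled node ALONE)**: a connected locally finite graph with a chart `φ : V → ℤ²` TRANSLATED by a transitive
group of automorphisms (`φ(a • w) − φ(w)` independent of `w`) whose values span rank two has `θ_v(p_c) = 0` at every vertex — no step, Lipschitz,
cylinder, stabiliser or growth hypothesis. [cite: BenjaminiSchramm1996, Conj. 4; §2] [cite: KozmaNitzan2024, §4 p. 16 (Lemma 8)] -/
theorem criticalContinuity_of_chart (hN : SamePDropOfSkeletonFrmScaled₁) (hact : IsActionByAut G A) (hc : G.Connected) (t : V)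
    (htr : ∀ v : V, ∃ a : A, a • t = v) (φ : V → Site 2) (hφ : ∀ (a : A) (w : V), φ (a • w) = φ w + (φ (a • t) - φ t))
    (hrank : ∃ x y : V, MaxArea.det2 (φ x - φ t) (φ y - φ t) ≠ 0) (v : V) : theta G v (criticalProbIOf G v) = 0 := by
  refine criticalContinuity hN hact hc t htr (chartHom t φ hφ) (fun h hh => ?_) ?_ v
  · show Multiplicative.ofAdd (φ (h • t) - φ t) = 1
    rw [MulAction.mem_stabilizer_iff.1 hh, sub_self, ofAdd_zero]
  · obtain ⟨x, y, hxy⟩ := hrank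
    obtain ⟨a, rfl⟩ := htr x
    obtain ⟨b, rfl⟩ := htr y
    exact ⟨a, b, by rwa [toAdd_chartHom, toAdd_chartHom]⟩

/-! ## Subgroups of `Aut(G)`, and the EQUIVALENCE with the node's interface off exponential growth -/

/-- The tautological action of `Aut(G)` on the vertices (local instance only). [folklore] -/
@[reducible] def autMulAction (G : SimpleGraph V) : MulAction (G ≃g G) V where
  smul γ v := γ v
  one_smul _ := rfl
  mul_smul _ _ _ := rfl

/-- **THEOREM (subgroups of `Aut(G)`, modulo the scaled node ALONE)**: a connected locally finite graph with a subgroup `A ≤ Aut(G)` acting TRANSITIVELY and a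
chart `φ : V → ℤ²` translated by `A` with values of rank two has `θ_v(p_c) = 0` at every vertex. [cite: BenjaminiSchramm1996, Conj. 4; §2] -/
theorem criticalContinuity_of_autSubgroup (hN : SamePDropOfSkeletonFrmScaled₁) (hc : G.Connected) (t : V) (A : Subgroup (G ≃g G))
    (htr : ∀ v : V, ∃ α ∈ A, α t = v) (φ : V → Site 2) (hφ : ∀ α ∈ A, ∀ w : V, φ (α w) = φ w + (φ (α t) - φ t))
    (hrank : ∃ x y : V, MaxArea.det2 (φ x - φ t) (φ y - φ t) ≠ 0) (v : V) : theta G v (criticalProbIOf G v) = 0 := by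
  letI : MulAction (G ≃g G) V := autMulAction G
  have hact : IsActionByAut G A := fun a x y => (a : G ≃g G).map_rel_iff'
  exact criticalContinuity_of_chart hN hact hc t (fun w => by obtain ⟨α, hα, hw⟩ := htr w; exact ⟨⟨α, hα⟩, hw⟩) φ
    (fun a w => hφ a a.2 w) hrank v

/-- **EQUIVALENCE WITH THE INTERFACE OF THE OPEN NODE**: for a connected locally finite graph WITHOUT exponential growth, a one-type `PlanarSkeletonFrmScaled` based
at `t` EXISTS iff some subgroup of `Aut(G)` acts transitively and translates a chart `V → ℤ²` whose values have rank two (⟹: the chart-translating automorphisms,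
gen 24's `FrmScaledAut`; ⟸: `exists_oneType_skeleton`).  On graphs of exponential growth `θ(p_c) = 0` holds outright (Hutchcroft), so the conditional theorem
`criticalContinuity_of_autSubgroup` covers EXACTLY the class of the node `U_s` where anything is open. [cite: BenjaminiSchramm1996, Conj. 4]
[cite: KozmaNitzan2024, §4 p. 16 (Lemma 8)] [cite: Hutchcroft2016, Thm. 1.1] -/
theorem exists_oneType_skeleton_iff (hG : ¬ HasExponentialGrowth G) (hc : G.Connected) (t : V) :
    (∃ Φ : PlanarSkeletonFrmScaled G, Φ.types = {t}) ↔
      ∃ (A : Subgroup (G ≃g G)) (φ : V → Site 2), (∀ v : V, ∃ α ∈ A, α t = v) ∧ (∀ α ∈ A, ∀ w : V, φ (α w) = φ w + (φ (α t) - φ t)) ∧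
        ∃ x y : V, MaxArea.det2 (φ x - φ t) (φ y - φ t) ≠ 0 := by
  constructor
  · rintro ⟨Φ, ht⟩
    obtain ⟨A, hA, htrA, -⟩ := FrmScaledAut.translating_transitive_rankTwo Φ ht
    refine ⟨A, Φ.φ, htrA, hA, ?_⟩
    obtain ⟨x, -, hx⟩ := Φ.step t 0 1
    obtain ⟨y, -, hy⟩ := Φ.step t 1 1
    refine ⟨x, y, ?_⟩
    have hN : Φ.N ≠ 0 := by have := Φ.one_le_N; omega
    rw [hx, hy, Units.val_one, mul_one, add_sub_cancel_left, add_sub_cancel_left, MaxArea.det2]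
    simp [hN]
  · rintro ⟨A, φ, htr, hφ, hrank⟩
    letI : MulAction (G ≃g G) V := autMulAction G
    have hact : IsActionByAut G A := fun a x y => (a : G ≃g G).map_rel_iff'
    have htr' : ∀ w : V, ∃ a : A, a • t = w := fun w => by obtain ⟨α, hα, hw⟩ := htr w; exact ⟨⟨α, hα⟩, hw⟩
    refine exists_oneType_skeleton hact hc t htr' (chartHom t φ (fun a w => hφ a a.2 w)) (fun h hh => ?_) ?_ hG
    · show Multiplicative.ofAdd (φ (h • t) - φ t) = 1
      rw [MulAction.mem_stabilizer_iff.1 hh, sub_self, ofAdd_zero]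
    · obtain ⟨x, y, hxy⟩ := hrank
      obtain ⟨a, rfl⟩ := htr' x
      obtain ⟨b, rfl⟩ := htr' y
      exact ⟨a, b, by rwa [toAdd_chartHom, toAdd_chartHom]⟩

end AutChart

end Summit.CriticalPhenomena.PercolationContinuityZ3.Theorems.Transplant

end
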